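import Summits.QuantumFields.YangMills.Theorems.BalabanUVNodesN11NodeFacesAtCRLetteredMemberDoorOfBgFactsZ
import Summits.QuantumFields.YangMills.Theorems.BalabanUVNodesN11AtCRLetteredMemberDoorExplicitWindow

/-!
# DAG node N11 — N11's PRINTED FACE `B16.Thm1Printed` AT THE cR-LETTERED z-MEMBER ON THE GUARD-FREE bg ROAD: the capstone at `gaussPinH θ` for every H-extension of
# `θ₁₃ᶻ(n_c, ε₂₉; Efl, logz) = theta13LiveOfNumericsZ F N n_c ε₂₉ ζ Rz Zt Efl logz` (generic key ∕ door key-included), «γ sufficiently small» quantified (∃ and explicit-window forms) —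
# dag-n11-w5 g2's p631153 + this seat's p633325 ∕ p639888 §2 RE-ISSUED BY TOKEN-PASS at DEF-1's Z family (№218 (3); dag-n11-w5 g3's №9 LINEAGE CENSUS I.40641 cedes the cR-lettered
# members' Z status to this seat's chain)

HEADER — WORK-UNIT METADATA.  Cell `pub-ymgap`, YM-PLAN Track A (HUMAN RULING D-0062 ∕ D-0149 width seats), seat `pub-ymgap-dag-n11-w3` (g5; WIDTH SEAT 3∕4 on NODE n11 [B14]),
route `BalabanUVNodes` rev 29, item K1⁹ `StabilityBRunRowsAtRecordR13SepCoPHV` = stmt-QuantumFields-27364 (helper lane `--kind proof --supports 27364 --as helper`, count-neutral) ·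
FLAG №9 z-witness re-key (director-ym №218 (3)).  [III] = [Balaban1988Convergent], [15] = [Balaban1985Variational], [I] = [Balaban1987RG1], [IV] = [Balaban1989LargeFieldI],
[V] = [Balaban1989LargeFieldII].  Over (BY NAME): dag-n11-w1 H5 p627901 (★★★★★ `thm1Printed_datumOfRecord₁₃SepCoPH_gaussPinH_of_supplierBorel_of_bgFacts_of_powM`, θ-generic);
this seat's Z-a p643546 (`two_le_cR_of_ccmwCRZH`, `numericRows_of_ccmwCRZH`), Z-b p644729 (`hcompBoth_ccmwCRZ_of_betaBoxSignFree`, `bgFacts_ccmwCRZH_of_thm1GaugeR_of_hcomp_of_hjm`, the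
z-door theorem), g4 p619867 (`ccmwCR_pos`), g3 p608030 (`exists_window_ccmShape`), p639888 (`ccmShape_of_le_explicitWindow`); DEF-1 Z2 (`admissible_theta13OfNumericsZ`).

WHY THIS FILE.  dag-n11-w5 g2's p631153 is the capstone at the cR-lettered W-member; the K1 door re-keys to DEF-1's z-witness (FLAG №9), where LOCATED-cR persists.  With this seat's
Z-a ∕ Z-b ∕ p645930 ∕ p646586 the z-member chain lacks only the printed face; dag-n11-w5 g3 closed (I.40641) crediting the cR-lettered members' Z status to this chain, so the printed
face's token-pass is typed here, together with its two «γ sufficiently small» forms (this seat's p633325 ∕ p639888 §2).  Proofs = the W texts VERBATIM under «`theta13LiveOfNumerics …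
Zt ↦ theta13LiveOfNumericsZ … Zt Efl logz`, `theta13OfThm1CCMW … a₁ ↦ theta13OfThm1CCMWZ … a₁ Efl logz`, `…ccmwCR… ↦ …ccmwCRZ…`» (H5 is θ-generic).

WHAT THIS FILE PROVES (5 theorems, 0 `def`, 0 `sorry`; standard axioms).
§1 ★★★★★ `thm1Printed_gaussPinH_ccmwCRZH_of_supplierBorel_of_solvable_of_hjm` (generic key) · ★★★★★ `thm1Printed_gaussPinH_door_ccmwCRZ_of_supplierBorel_of_solvable_of_hjm` (door, key included);
§2 ★★★★ `exists_window_thm1Printed_gaussPinH_ccmwCRZH_of_betaBox` · ★★★★ `exists_window_thm1Printed_gaussPinH_door_ccmwCRZ_of_betaBox` (∃ γ₁₁ⁿᵘᵐ(L, j, N));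
§3 ★★★★ `thm1Printed_gaussPinH_door_ccmwCRZ_of_le_explicitWindow` (γ₁₁ⁿᵘᵐ(L, j, N) value in the type).

HONEST FRAMING ∕ A6.  Helper lane, count-neutral token-pass of LANDED kernel bookkeeping; nothing of Bałaban asserted.  DISPLAYED (hypotheses, NOT discharged, inhabited nowhere in the
tree): (8) `VariationalThm1RegSepCoP7M`, the (9)-step `Gauge9RegSepTopStepR`, the sign-free β-box of `betaOfRecord₁₃ F N θ₁₅ᶜᶜᴹᵂᶻ(j; γ; Efl, logz)` (`−bₗ·γ² ≤ 3`, `β′·γ² ≤ ¾`), K0's per-cube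
[15]-solvability on the windowed runs, [III] §3's supplier (`SupplierObligations ∧ SupplierBorel` — XL), §1's generic key.  NO value of `E_k ∕ log z_k` pinned or read; NOT a claim that the
z-member is K1⁹'s witness; FLAG №9 NOT closed by this.  Non-wrapping families only (`j + 1 ≤ F.m`); `c ∈ [2, 8]`.  NOT a re-pin (no `def`); N11 NOT discharged; K0⁷ ∕ K1⁹ NOT closed, no stub
touched; counts unmoved (typed 28∕28 · discharged 5∕27 · A 5∕28).  One finite `𝕋⁴_{L^K}` programme at fixed `ε = L^{−K}`; `route-QuantumFields-BalabanUVNodes` closes ONLY the CONDITIONAL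
finite-𝕋⁴ rung `BalabanLadder.UV` — NOT ℝ⁴, NOT OS, NOT the Yang–Mills mass gap (Clay).  No `sorry`, no `axiom`, no `def`, no `instance`, no `notation`.
Sources (SHAPE only): [III] Thm 1 p.262, Theorem p.245, §3 p.279, (0.2) p.244, (1.15) p.249, (2.4)–(2.5) p.255, (2.10) p.256, (2.28) p.259, (3.16)–(3.25) pp.268–270; [15] (6)–(7) p.278,
Thm 1 (7)–(9) pp.278–279, (144)–(152) pp.300–301, Prop. 8 p.304; [I] Thm 1 p.259, (0.20) p.256, (1.12) p.262, (1.20)–(1.22) p.264; [IV] (0.2)–(0.4) p.176; [V] Thm 1 p.355.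
-/

noncomputable section

open MeasureTheory
open scoped BigOperators ENNReal NNReal Matrix.Norms.L2Operator

namespace Summit.QuantumFields.YangMills.Theorems.BalabanUVNodesN11Thm1PrintedAtCRLetteredMemberOfBgFactsZ

open Literature.MathematicalPhysics.QuantumFieldTheory.Balaban1983to89 T4Continuum T4NestedCovariance Node00 Node00.Tk DagBinding
open B15DeterminingSets B8Eq17ClassAkV1 B14.Eq218Concrete B10Eq42TorusConstraint FlowStep
open B14.Eq213MaximalDomains (side)
open B14.Eq213DetSet (Bj)
open Literature.MathematicalPhysics.QuantumFieldTheory.BalabanImbrieJaffe1984to88.BIJ85Eq453GaugeField (qsstarGIter0)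
open BalabanUVNodesN11HistoryPinnedResidualDefs BalabanUVNodesN11RePinnedParamDefs
open BalabanUVNodesN11GaussianCertificateDefs (gaussPinH provisos₁₃CoPH_gaussPinH)
open BalabanUVNodesN11Sect3SupplyChainDefs
open BalabanUVNodesN11Sect3SupplyChainBorelB
open BalabanUVNodesN11Sect3SupplyChainObligationsDefs
open BalabanUVNodesN11Sect3SupplyChainBorelBThm1PrintedOfSolvable (provisos₁₃SepCoPH_gaussPinH)
open BalabanUVNodesN11Sect3SupplyChainBorelBThm1PrintedOfBgFacts (thm1Printed_datumOfRecord₁₃SepCoPH_gaussPinH_of_supplierBorel_of_bgFacts_of_powM)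
open BalabanUVNodesN11SupplyChainAtCRLetteredNumerics (ccmwCR_pos)
open BalabanUVNodesN11SupplyChainAtCRLetteredNumericsZ (two_le_cR_of_ccmwCRZH nesting_of_ccmwCRZH numericRows_of_ccmwCRZH)
open BalabanUVNodesN11K0DoorAtCRLetteredNumericsZ (hcompBoth_ccmwCRZ_of_betaBoxSignFree provisos₁₃SepCoPH_door_ccmwCRZ_of_gauge9TopStepR_of_betaBoxSignFree_allTorus
  bgFacts_ccmwCRZH_of_thm1GaugeR_of_hcomp_of_hjm)
open BalabanUVNodesN11NoExpansionNumericsAtThm1CCMW (exists_window_ccmShape)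
open BalabanUVNodesN11AtCRLetteredMemberDoorExplicitWindow (ccmShape_of_le_explicitWindow)

/-! ## §1  The printed face at the z-member: generic key, and the door (key included) -/

section Capstone

variable {F : T4Family} {N : ℕ} [NeZero N] {j c₁₅ : ℕ} {γ c ε₀ ε₂₉ B₃ B₃' a₀ a₁ : ℝ} {Efl logz : B12.RunParams → ℕ → ℝ} {θ : Stage13HParams F N}

/-- **★★★★★ THE CAPSTONE — N11's PRINTED OUTPUT `B16.Thm1Printed` AT THE K1-KEYED DATUM OF THE GAUSSIAN CERTIFICATE OVER ANY H-EXTENSION OF THE cR-LETTERED z-MEMBER (token-pass of dag-n11-w5 p631153), WITH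
THE bg BINDER AND THE RUN GUARD BOTH GONE**: dag-n11-w1 g3's ★★★★★ `thm1Printed_datumOfRecord₁₃SepCoPH_gaussPinH_of_supplierBorel_of_bgFacts_of_powM` (p627901) at `θ` with
`θ.toStage13Params = θ₁₃ᶻ(n_c, ε₂₉; Efl, logz)` (the member: θ₁₅ᶜᶜᴹᵂ's numerics with `s2.cR := c`, `2 ≤ c ≤ 8`), its `hbgs` DISCHARGED by `…BgRowGaugeRAtCRLetteredMember` §3 (the GaugeR
road — (8), (9), the β-box's (hcomp)∧(hcompRev), `j + 1 ≤ F.m`; NO `PartCompat₁₃`), `hcR` by `two_le_cR_of_ccmwCRZH`, the five numeric rows by `numericRows_of_ccmwCRZH` (the four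
γ-conditions), nesting ∕ `M = L^j` ∕ `0 < M₁ ≤ M` ∕ the live selector ∕ the signs of `κ, E₀, B₀` by `rfl`-numerals.  REMAINING displayed hypotheses: the key `h : θ.Provisos₁₃SepCoPH`
(at the history-blind door it is dag-n11-w3's door theorem — next theorem), the window∕sign letters, (8) `h15`, (9) `h9`, the sign-free β-box, `2 ≤ c ≤ 8`, `hjm`, K0's per-cube
[15]-solvability `hsolv` along the windowed runs, and [III] §3's supplier `σ` with `SupplierObligations ∧ SupplierBorel` on the windowed runs — NO bg binder, NO run guard, NO
geometric row.  CONDITIONAL; nothing of Bałaban asserted; NOT a discharge of N11 (the supplier is [III] §3, XL; the solvability is K0⁷'s).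
[cite: Balaban1988Convergent, Thm 1 p.262, Theorem p.245, §3 p.279, (0.2) p.244, (2.28) p.259, (3.16) p.268, (3.24)–(3.25) p.270; Balaban1989LargeFieldII, Thm 1 p.355; Balaban1989LargeFieldI, (0.3)–(0.4) p.176; Balaban1985Variational, (6)–(7) p.278, Thm 1 (8)–(9) p.279, (144)–(152) pp.300–301; Balaban1987RG1, Thm 1 p.259, (0.20) p.256, (1.12) p.262] -/
theorem thm1Printed_gaussPinH_ccmwCRZH_of_supplierBorel_of_solvable_of_hjm
    (hθ : θ.toStage13Params = theta13LiveOfNumericsZ F N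
      ({ stage12NumericsOfThm1CCMW F.L j γ ε₀ B₃ B₃' a₀ a₁ with s2 := { sect2NumericsOfThm1C F.L with cR := c } } : Stage12Numerics) ε₂₉
      (zeta316OfRecord F N (stage12NumericsOfThm1CCMW F.L j γ ε₀ B₃ B₃' a₀ a₁).ν (stage12NumericsOfThm1CCMW F.L j γ ε₀ B₃ B₃' a₀ a₁).τ9.M
        (stage12NumericsOfThm1CCMW F.L j γ ε₀ B₃ B₃' a₀ a₁).A₁) (RzOfRecord F N) (ZtOfRecord F N) Efl logz)
    (hjm : j + 1 ≤ F.m) (hc2 : 2 ≤ c) (hc8 : c ≤ 8) (hj : 1 ≤ j) (hε : 0 < ε₀) (hε' : 0 < ε₂₉) (hB : 0 ≤ B₃) (hB' : 0 ≤ B₃') (ha₀ : 0 < a₀) (ha₁ : 0 < a₁)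
    (hγ0 : 0 < γ) (hγe : γ ≤ Real.exp (-1))
    (h3γ : 3 * (F.L : ℝ) ^ j ≤ F.L * Real.log (γ ^ 2)⁻¹) (hRγ : ((8 * F.L + 3 : ℕ) : ℝ) ≤ F.L * Real.log (γ ^ 2)⁻¹)
    (hε3γ : 36608 * (γ * Real.log (γ ^ 2)⁻¹) ≤ 16 / 3) (hε2γ : γ * Real.log (γ ^ 2)⁻¹ ≤ 16 * ExpMeanLog.deltaSU (Fin N) / ((8 * F.L : ℕ) : ℝ) ^ 2)
    (h15 : VariationalThm1RegSepCoP7M F N B₃ a₀ a₁) (hc₁₅ : c₁₅ ≤ F.L ^ j)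
    (h9 : Gauge9RegSepTopStepR F N (fun ν K Ω => suppDomOfRecord F ν K Ω) (F.L ^ j) c₁₅ B₃ B₃' a₀ a₁)
    {bl β' : ℝ} (hbox : BetaLowerH bl γ (betaOfRecord₁₃ F N (theta13OfThm1CCMWZ F N j γ ε₀ ε₂₉ B₃ B₃' a₀ a₁ Efl logz)))
    (hbox' : BetaUpperH β' γ (betaOfRecord₁₃ F N (theta13OfThm1CCMWZ F N j γ ε₀ ε₂₉ B₃ B₃' a₀ a₁ Efl logz))) (hl : -bl * γ ^ 2 ≤ 3) (hβ' : β' * γ ^ 2 ≤ 3 / 4)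
    (h : θ.Provisos₁₃SepCoPH F N)
    (hsolv : ∀ P : B12.RunParams, Step.InInterval γ P.K (gOfRecord₁₃ F N θ.toStage13Params P) → ∀ i, 1 ≤ i → i ≤ P.K →
      ∀ (s : SeqOfRecord F θ.toStage13Params.ν θ.toStage13Params.τ9.M (gOfRecord₁₃ F N θ.toStage13Params P) P.K i) (V : GaugeField (F.P P.K) i (SU N)),
      chiSeqOfRecord F N θ.toStage13Params.ν θ.toStage13Params.τ9.M (gOfRecord₁₃ F N θ.toStage13Params P) P.K i s V ≠ 0 →
      ∀ a ∈ cubesIn (fun a : ↥(cubeIndices (F.P P.K) (cubeSide (F.P P.K).L θ.toStage13Params.ν.M₂ (RkOfRecord (F.P P.K).L θ.toStage13Params.ν.r (gOfRecord₁₃ F N θ.toStage13Params P i)) i)) =>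
          cubeEnl (F.P P.K) (cubeSide (F.P P.K).L θ.toStage13Params.ν.M₂ (RkOfRecord (F.P P.K).L θ.toStage13Params.ν.r (gOfRecord₁₃ F N θ.toStage13Params P i)) i) a 0) (s.Ω i),
        ∃ U₀, IsMinimizer (avOfRecord F N P.K) {U | PlaqSmall (θ.toStage13Params.ν.εreg * (F.P P.K).eta i ^ 2) U}
          (Bj θ.toStage13Params.ν.M₁ (cubeEnl (F.P P.K) (cubeSide (F.P P.K).L θ.toStage13Params.ν.M₂ (RkOfRecord (F.P P.K).L θ.toStage13Params.ν.r (gOfRecord₁₃ F N θ.toStage13Params P i)) i) a 4) i)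
          (avgFamily (avOfRecord F N P.K) (qsstarGIter0 i V)) U₀)
    (σ : (P : B12.RunParams) → Sect3Supplier (gaussPinH θ) P)
    (hσ : ∀ P : B12.RunParams, Step.InInterval γ P.K (gOfRecord₁₃ F N θ.toStage13Params P) → SupplierObligations (gaussPinH θ) P (σ P))
    (hσB : ∀ P : B12.RunParams, Step.InInterval γ P.K (gOfRecord₁₃ F N θ.toStage13Params P) → SupplierBorel (gaussPinH θ) P (σ P)) :
    B16.Thm1Printed (datumOfRecord₁₃SepCoPH F N (gaussPinH θ) (provisos₁₃SepCoPH_gaussPinH h)).C := by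
  have hγh : γ ≤ 1 / 2 := hγe.trans (Real.exp_neg_one_lt_d9.le.trans (by norm_num))
  -- the member's θ-level letters (dag-n11-w3 g4), read BEFORE destructuring `θ`
  have hrows := fun (P : B12.RunParams) (hw : Step.InInterval γ P.K (gOfRecord₁₃ F N θ.toStage13Params P)) =>
    numericRows_of_ccmwCRZH hθ hB hB' ha₀ ha₁ hγ0 hγe h3γ hRγ hε3γ hε2γ P hw
  have hcR := two_le_cR_of_ccmwCRZH hθ hc2
  obtain ⟨⟨θ₁, Zr⟩, Zh, Phih⟩ := θ
  obtain rfl : θ₁ = _ := hθ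
  -- (hcomp) ∧ (hcompRev) at the member from the sign-free β-box, then the bg facts WITHOUT the run guard (this seat's GaugeR road at the member)
  have H := hcompBoth_ccmwCRZ_of_betaBoxSignFree (F := F) (N := N) (j := j) (c := c) (ε₀ := ε₀) (ε₂₉ := ε₂₉) (B₃ := B₃) (B₃' := B₃') (a₀ := a₀) (a₁ := a₁)
    (θ := theta13LiveOfNumericsZ F N ({ stage12NumericsOfThm1CCMW F.L j γ ε₀ B₃ B₃' a₀ a₁ with s2 := { sect2NumericsOfThm1C F.L with cR := c } } : Stage12Numerics) ε₂₉ (zeta316OfRecord F N (stage12NumericsOfThm1CCMW F.L j γ ε₀ B₃ B₃' a₀ a₁).ν (stage12NumericsOfThm1CCMW F.L j γ ε₀ B₃ B₃' a₀ a₁).τ9.M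
        (stage12NumericsOfThm1CCMW F.L j γ ε₀ B₃ B₃' a₀ a₁).A₁) (RzOfRecord F N) (ZtOfRecord F N) Efl logz)
    rfl (by linarith) hγh hB hB' ha₀.le ha₁.le hbox hbox' hl hβ'
  have hbgs := bgFacts_ccmwCRZH_of_thm1GaugeR_of_hcomp_of_hjm
    (θH := (⟨⟨theta13LiveOfNumericsZ F N ({ stage12NumericsOfThm1CCMW F.L j γ ε₀ B₃ B₃' a₀ a₁ with s2 := { sect2NumericsOfThm1C F.L with cR := c } } : Stage12Numerics) ε₂₉ (zeta316OfRecord F N (stage12NumericsOfThm1CCMW F.L j γ ε₀ B₃ B₃' a₀ a₁).ν (stage12NumericsOfThm1CCMW F.L j γ ε₀ B₃ B₃' a₀ a₁).τ9.M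
        (stage12NumericsOfThm1CCMW F.L j γ ε₀ B₃ B₃' a₀ a₁).A₁) (RzOfRecord F N) (ZtOfRecord F N) Efl logz, Zr⟩, Zh, Phih⟩ : Stage13HParams F N))
    rfl rfl hjm (by linarith) hc8 hγ0 hγh hε hε' hB hB' ha₀ ha₁ h15 hc₁₅ (variationalThm1GaugeRegSepCoP7MR_of_gauge9TopStepR h9) H.1 H.2 (γ' := γ) le_rfl
  have hγ1 : γ < 1 := hγe.trans_lt (Real.exp_lt_one_iff.mpr (by norm_num))
  have hpos := ccmwCR_pos (L := F.L) (j := j) (ε₀ := ε₀) (B₃ := B₃) (B₃' := B₃') (a₀ := a₀) (a₁ := a₁) (by have := F.hL11; omega) hγ0 hγ1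
    (by linarith : (0 : ℝ) < c) hε hB hB' ha₀ ha₁
  have hadm := (admissible_theta13OfNumericsZ (n := ({ stage12NumericsOfThm1CCMW F.L j γ ε₀ B₃ B₃' a₀ a₁ with s2 := { sect2NumericsOfThm1C F.L with cR := c } } : Stage12Numerics)) F N (zeta316OfRecord F N (stage12NumericsOfThm1CCMW F.L j γ ε₀ B₃ B₃' a₀ a₁).ν (stage12NumericsOfThm1CCMW F.L j γ ε₀ B₃ B₃' a₀ a₁).τ9.M
        (stage12NumericsOfThm1CCMW F.L j γ ε₀ B₃ B₃' a₀ a₁).A₁) (RzOfRecord F N) (ZtOfRecord F N) Efl logz hpos hε').liveRepin₁₃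
  refine thm1Printed_datumOfRecord₁₃SepCoPH_gaussPinH_of_supplierBorel_of_bgFacts_of_powM _ h rfl hadm
    (by change (0 : ℝ) ≤ 20000; norm_num) (by change (0 : ℝ) ≤ 1; norm_num) (by change (0 : ℝ) ≤ 1; norm_num)
    (show 0 < F.L ^ j from pow_pos (by have := F.hL11; omega) _) le_rfl hcR hγ0 hbgs ?_ (a := j) rfl
    (fun P hw => (hrows P hw).1) (fun P hw => (hrows P hw).2.1) (fun P hw => (hrows P hw).2.2.1) (fun P hw => (hrows P hw).2.2.2.1)
    (fun P hw => (hrows P hw).2.2.2.2) hsolv σ hσ hσB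
  show F.L * 1 ∣ F.L ^ j
  rw [mul_one]
  exact dvd_pow_self _ (by omega)

/-- **★★★★★ THE SAME OVER THE z-MEMBER's HISTORY-BLIND DOOR, KEY INCLUDED**: the key `h` is dag-n11-w3 g4's door theorem
`provisos₁₃SepCoPH_door_ccmwCRZ_of_gauge9TopStepR_of_betaBoxSignFree_allTorus` (Part 14 §0c's K0-side inputs VERBATIM + `0 < c ≤ 8`), so at
`θ := Stage13HParams.ofHistoryBlind F N ⟨θ₁₃ᶻ(n_c, ε₂₉; Efl, logz), ZrOfRecord₁₃ …⟩` N11's PRINTED OUTPUT at the Gaussian certificate's K1-keyed datum follows from: the window∕sign letters and the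
four γ-conditions, (8) `h15`, (9) `h9`, the sign-free β-box, `2 ≤ c ≤ 8`, `1 ≤ j`, `j + 1 ≤ F.m`, K0's per-cube [15]-solvability along the windowed runs, and [III] §3's supplier with
`SupplierObligations ∧ SupplierBorel` on the windowed runs — NOTHING ELSE (no bg binder, no run guard, no geometric row, no `hsel`∕numeral side conditions).  CONDITIONAL; nothing of
Bałaban asserted; NOT a discharge. [cite: Balaban1988Convergent, Thm 1 p.262, Theorem p.245, §3 p.279, (2.28) p.259, (3.24)–(3.25) p.270; Balaban1989LargeFieldII, Thm 1 p.355; Balaban1985Variational, Thm 1 (8)–(9) p.279, (144)–(152) pp.300–301, Prop. 8 p.304; Balaban1987RG1, Thm 1 p.259, (0.20) p.256, (1.20)–(1.22) p.264] -/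
theorem thm1Printed_gaussPinH_door_ccmwCRZ_of_supplierBorel_of_solvable_of_hjm {θ₀ : Stage13Params F N}
    (hθ₀ : θ₀ = theta13LiveOfNumericsZ F N
      ({ stage12NumericsOfThm1CCMW F.L j γ ε₀ B₃ B₃' a₀ a₁ with s2 := { sect2NumericsOfThm1C F.L with cR := c } } : Stage12Numerics) ε₂₉
      (zeta316OfRecord F N (stage12NumericsOfThm1CCMW F.L j γ ε₀ B₃ B₃' a₀ a₁).ν (stage12NumericsOfThm1CCMW F.L j γ ε₀ B₃ B₃' a₀ a₁).τ9.M
        (stage12NumericsOfThm1CCMW F.L j γ ε₀ B₃ B₃' a₀ a₁).A₁) (RzOfRecord F N) (ZtOfRecord F N) Efl logz)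
    (hjm : j + 1 ≤ F.m) (hc2 : 2 ≤ c) (hc8 : c ≤ 8) (hj : 1 ≤ j) (hε : 0 < ε₀) (hε' : 0 < ε₂₉) (hB : 0 ≤ B₃) (hB' : 0 ≤ B₃') (ha₀ : 0 < a₀) (ha₁ : 0 < a₁)
    (hγ0 : 0 < γ) (hγe : γ ≤ Real.exp (-1))
    (h3γ : 3 * (F.L : ℝ) ^ j ≤ F.L * Real.log (γ ^ 2)⁻¹) (hRγ : ((8 * F.L + 3 : ℕ) : ℝ) ≤ F.L * Real.log (γ ^ 2)⁻¹)
    (hε3γ : 36608 * (γ * Real.log (γ ^ 2)⁻¹) ≤ 16 / 3) (hε2γ : γ * Real.log (γ ^ 2)⁻¹ ≤ 16 * ExpMeanLog.deltaSU (Fin N) / ((8 * F.L : ℕ) : ℝ) ^ 2)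
    (h15 : VariationalThm1RegSepCoP7M F N B₃ a₀ a₁) (hc₁₅ : c₁₅ ≤ F.L ^ j)
    (h9 : Gauge9RegSepTopStepR F N (fun ν K Ω => suppDomOfRecord F ν K Ω) (F.L ^ j) c₁₅ B₃ B₃' a₀ a₁)
    {bl β' : ℝ} (hbox : BetaLowerH bl γ (betaOfRecord₁₃ F N (theta13OfThm1CCMWZ F N j γ ε₀ ε₂₉ B₃ B₃' a₀ a₁ Efl logz)))
    (hbox' : BetaUpperH β' γ (betaOfRecord₁₃ F N (theta13OfThm1CCMWZ F N j γ ε₀ ε₂₉ B₃ B₃' a₀ a₁ Efl logz))) (hl : -bl * γ ^ 2 ≤ 3) (hβ' : β' * γ ^ 2 ≤ 3 / 4)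
    (hsolv : ∀ P : B12.RunParams, Step.InInterval γ P.K (gOfRecord₁₃ F N θ₀ P) → ∀ i, 1 ≤ i → i ≤ P.K →
      ∀ (s : SeqOfRecord F θ₀.ν θ₀.τ9.M (gOfRecord₁₃ F N θ₀ P) P.K i) (V : GaugeField (F.P P.K) i (SU N)),
      chiSeqOfRecord F N θ₀.ν θ₀.τ9.M (gOfRecord₁₃ F N θ₀ P) P.K i s V ≠ 0 →
      ∀ a ∈ cubesIn (fun a : ↥(cubeIndices (F.P P.K) (cubeSide (F.P P.K).L θ₀.ν.M₂ (RkOfRecord (F.P P.K).L θ₀.ν.r (gOfRecord₁₃ F N θ₀ P i)) i)) =>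
          cubeEnl (F.P P.K) (cubeSide (F.P P.K).L θ₀.ν.M₂ (RkOfRecord (F.P P.K).L θ₀.ν.r (gOfRecord₁₃ F N θ₀ P i)) i) a 0) (s.Ω i),
        ∃ U₀, IsMinimizer (avOfRecord F N P.K) {U | PlaqSmall (θ₀.ν.εreg * (F.P P.K).eta i ^ 2) U}
          (Bj θ₀.ν.M₁ (cubeEnl (F.P P.K) (cubeSide (F.P P.K).L θ₀.ν.M₂ (RkOfRecord (F.P P.K).L θ₀.ν.r (gOfRecord₁₃ F N θ₀ P i)) i) a 4) i)
          (avgFamily (avOfRecord F N P.K) (qsstarGIter0 i V)) U₀)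
    (σ : (P : B12.RunParams) → Sect3Supplier (gaussPinH (Stage13HParams.ofHistoryBlind F N ⟨θ₀, ZrOfRecord₁₃ F N θ₀⟩)) P)
    (hσ : ∀ P : B12.RunParams, Step.InInterval γ P.K (gOfRecord₁₃ F N θ₀ P) → SupplierObligations (gaussPinH (Stage13HParams.ofHistoryBlind F N ⟨θ₀, ZrOfRecord₁₃ F N θ₀⟩)) P (σ P))
    (hσB : ∀ P : B12.RunParams, Step.InInterval γ P.K (gOfRecord₁₃ F N θ₀ P) → SupplierBorel (gaussPinH (Stage13HParams.ofHistoryBlind F N ⟨θ₀, ZrOfRecord₁₃ F N θ₀⟩)) P (σ P)) :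
    B16.Thm1Printed (datumOfRecord₁₃SepCoPH F N (gaussPinH (Stage13HParams.ofHistoryBlind F N ⟨θ₀, ZrOfRecord₁₃ F N θ₀⟩))
      (provisos₁₃SepCoPH_gaussPinH (provisos₁₃SepCoPH_door_ccmwCRZ_of_gauge9TopStepR_of_betaBoxSignFree_allTorus hθ₀ (by linarith) hc8 hγ0
        (hγe.trans (Real.exp_neg_one_lt_d9.le.trans (by norm_num))) hε hε' hB hB' ha₀ ha₁ h15 hc₁₅ h9 hbox hbox' hl hβ'))).C :=
  thm1Printed_gaussPinH_ccmwCRZH_of_supplierBorel_of_solvable_of_hjm (θ := Stage13HParams.ofHistoryBlind F N ⟨θ₀, ZrOfRecord₁₃ F N θ₀⟩) (by subst hθ₀; rfl)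
    hjm hc2 hc8 hj hε hε' hB hB' ha₀ ha₁ hγ0 hγe h3γ hRγ hε3γ hε2γ h15 hc₁₅ h9 hbox hbox' hl hβ'
    (provisos₁₃SepCoPH_door_ccmwCRZ_of_gauge9TopStepR_of_betaBoxSignFree_allTorus hθ₀ (by linarith) hc8 hγ0
      (hγe.trans (Real.exp_neg_one_lt_d9.le.trans (by norm_num))) hε hε' hB hB' ha₀ ha₁ h15 hc₁₅ h9 hbox hbox' hl hβ') hsolv σ hσ hσB



end Capstone

/-! ## §2  «γ sufficiently small» quantified (∃ γ₁₁ⁿᵘᵐ) -/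

section Window

variable (F : T4Family) (N : ℕ) [NeZero N] {j : ℕ} (Efl logz : B12.RunParams → ℕ → ℝ)

/-- **★★★★ «γ SUFFICIENTLY SMALL» QUANTIFIED — N11's PRINTED OUTPUT AT `gaussPinH θ` ON THE GUARD-FREE bg ROAD AT EVERY cR-LETTERED z-MEMBER `c ∈ [2, 8]`, EVERY WINDOW LETTER
`γ ∈ ]0, γ₁₁ⁿᵘᵐ(L, j, N)]`, GENERIC KEY** (`1 ≤ j`, `j + 1 ≤ F.m`): there is an explicit `γ₁₁ⁿᵘᵐ > 0` (p608030 §1) such that for every such `γ`, `c`, [15]'s signs, (8), the (9)-step,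
the sign-free β-box of `betaOfRecord₁₃ F N θ₁₅ᶜᶜᴹᵂᶻ(j; γ; Efl, logz)`, every H-extension `θ` of `θ₁₃ᶻ(n_c, ε₂₉; Efl, logz)` with the key, K0's per-cube [15]-solvability and a [III] §3 supplier on the windowed runs,
`B16.Thm1Printed (datumOfRecord₁₃SepCoPH F N (gaussPinH θ) _).C` — §1's ★★★★★ `thm1Printed_gaussPinH_ccmwCRZH_of_supplierBorel_of_solvable_of_hjm` with its five γ-conditions
supplied by `exists_window_ccmShape`.  CONDITIONAL; nothing of Bałaban asserted.
[cite: Balaban1988Convergent, Thm 1 p.262, Theorem p.245, §3 p.279, (2.4)–(2.5) p.255, (2.10) p.256, (2.28) p.259; Balaban1987RG1, Thm 1 p.259 («contained in an interval ]0, γ] with a sufficiently small positive γ»), (0.20) p.256, (1.20)–(1.22) p.264; Balaban1989LargeFieldII, Thm 1 p.355; Balaban1989LargeFieldI, (0.3)–(0.4) p.176; Balaban1985Variational, Thm 1 (7)–(9) pp.278–279, (144)–(152) pp.300–301] -/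
theorem exists_window_thm1Printed_gaussPinH_ccmwCRZH_of_betaBox (hj : 1 ≤ j) (hjm : j + 1 ≤ F.m) :
    ∃ γ₀ : ℝ, 0 < γ₀ ∧ ∀ (γ c ε₀ ε₂₉ B₃ B₃' a₀ a₁ bl β' : ℝ) (c₁₅ : ℕ), 2 ≤ c → c ≤ 8 → 0 < ε₀ → 0 < ε₂₉ → 0 ≤ B₃ → 0 ≤ B₃' → 0 < a₀ → 0 < a₁ → 0 < γ → γ ≤ γ₀ →
      VariationalThm1RegSepCoP7M F N B₃ a₀ a₁ → c₁₅ ≤ F.L ^ j → Gauge9RegSepTopStepR F N (fun ν K Ω => suppDomOfRecord F ν K Ω) (F.L ^ j) c₁₅ B₃ B₃' a₀ a₁ →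
      BetaLowerH bl γ (betaOfRecord₁₃ F N (theta13OfThm1CCMWZ F N j γ ε₀ ε₂₉ B₃ B₃' a₀ a₁ Efl logz)) →
      BetaUpperH β' γ (betaOfRecord₁₃ F N (theta13OfThm1CCMWZ F N j γ ε₀ ε₂₉ B₃ B₃' a₀ a₁ Efl logz)) → -bl * γ ^ 2 ≤ 3 → β' * γ ^ 2 ≤ 3 / 4 →
      ∀ (θ : Stage13HParams F N), θ.toStage13Params = theta13LiveOfNumericsZ F N
          ({ stage12NumericsOfThm1CCMW F.L j γ ε₀ B₃ B₃' a₀ a₁ with s2 := { sect2NumericsOfThm1C F.L with cR := c } } : Stage12Numerics) ε₂₉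
          (zeta316OfRecord F N (stage12NumericsOfThm1CCMW F.L j γ ε₀ B₃ B₃' a₀ a₁).ν (stage12NumericsOfThm1CCMW F.L j γ ε₀ B₃ B₃' a₀ a₁).τ9.M
            (stage12NumericsOfThm1CCMW F.L j γ ε₀ B₃ B₃' a₀ a₁).A₁) (RzOfRecord F N) (ZtOfRecord F N) Efl logz →
      ∀ (h : θ.Provisos₁₃SepCoPH F N),
      (∀ P : B12.RunParams, Step.InInterval γ P.K (gOfRecord₁₃ F N θ.toStage13Params P) → ∀ i, 1 ≤ i → i ≤ P.K →
        ∀ (s : SeqOfRecord F θ.toStage13Params.ν θ.toStage13Params.τ9.M (gOfRecord₁₃ F N θ.toStage13Params P) P.K i) (V : GaugeField (F.P P.K) i (SU N)),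
        chiSeqOfRecord F N θ.toStage13Params.ν θ.toStage13Params.τ9.M (gOfRecord₁₃ F N θ.toStage13Params P) P.K i s V ≠ 0 →
        ∀ a ∈ cubesIn (fun a : ↥(cubeIndices (F.P P.K) (cubeSide (F.P P.K).L θ.toStage13Params.ν.M₂ (RkOfRecord (F.P P.K).L θ.toStage13Params.ν.r (gOfRecord₁₃ F N θ.toStage13Params P i)) i)) =>
            cubeEnl (F.P P.K) (cubeSide (F.P P.K).L θ.toStage13Params.ν.M₂ (RkOfRecord (F.P P.K).L θ.toStage13Params.ν.r (gOfRecord₁₃ F N θ.toStage13Params P i)) i) a 0) (s.Ω i),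
          ∃ U₀, IsMinimizer (avOfRecord F N P.K) {U | PlaqSmall (θ.toStage13Params.ν.εreg * (F.P P.K).eta i ^ 2) U}
            (Bj θ.toStage13Params.ν.M₁ (cubeEnl (F.P P.K) (cubeSide (F.P P.K).L θ.toStage13Params.ν.M₂ (RkOfRecord (F.P P.K).L θ.toStage13Params.ν.r (gOfRecord₁₃ F N θ.toStage13Params P i)) i) a 4) i)
            (avgFamily (avOfRecord F N P.K) (qsstarGIter0 i V)) U₀) →
      ∀ (σ : (P : B12.RunParams) → Sect3Supplier (gaussPinH θ) P),
      (∀ P : B12.RunParams, Step.InInterval γ P.K (gOfRecord₁₃ F N θ.toStage13Params P) → SupplierObligations (gaussPinH θ) P (σ P)) →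
      (∀ P : B12.RunParams, Step.InInterval γ P.K (gOfRecord₁₃ F N θ.toStage13Params P) → SupplierBorel (gaussPinH θ) P (σ P)) →
      B16.Thm1Printed (datumOfRecord₁₃SepCoPH F N (gaussPinH θ) (provisos₁₃SepCoPH_gaussPinH h)).C := by
  obtain ⟨γ₀, hγ₀, hall⟩ := exists_window_ccmShape (L := F.L) F.hL.2.le j N
  refine ⟨γ₀, hγ₀, fun γ c ε₀ ε₂₉ B₃ B₃' a₀ a₁ bl β' c₁₅ hc hc8 hε hε' hB hB' ha₀ ha₁ hγ hγle h15 hc₁₅ h9 hbox hbox' hl hβ' θ hθ h hsolv σ hσ hσB => ?_⟩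
  obtain ⟨hγe, h3γ, hRγ, hε3γ, hε2γ⟩ := hall γ hγ hγle
  exact thm1Printed_gaussPinH_ccmwCRZH_of_supplierBorel_of_solvable_of_hjm hθ hjm hc hc8 hj hε hε' hB hB' ha₀ ha₁ hγ hγe h3γ hRγ hε3γ hε2γ h15 hc₁₅ h9 hbox hbox' hl hβ'
    h hsolv σ hσ hσB

/-- **★★★★ «γ SUFFICIENTLY SMALL» QUANTIFIED AT THE z-MEMBER's HISTORY-BLIND DOOR, KEY INCLUDED**: there is an explicit `γ₁₁ⁿᵘᵐ(L, j, N) > 0` such that for every `γ ∈ ]0, γ₁₁ⁿᵘᵐ]`,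
every `c ∈ [2, 8]`, [15]'s signs, (8), the (9)-step, the sign-free β-box, and — on the windowed runs — K0's per-cube [15]-solvability and a [III] §3 supplier, N11's PRINTED OUTPUT holds at
`gaussPinH (ofHistoryBlind ⟨θ₁₃ᶻ(n_c, ε₂₉; Efl, logz), ZrOfRecord₁₃ …⟩)` — NOTHING ELSE displayed: the conclusion is «the KEY holds there (this seat's g4 door theorem) ∧ for EVERY proof
`hG` of the key, `B16.Thm1Printed` at the datum keyed by `hG`» (§1's door-keyed ★★★★★ with the five γ-conditions supplied; proof-irrelevant in `hG`).  CONDITIONAL; nothing of Bałaban asserted; NOT a discharge.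
[cite: Balaban1988Convergent, Thm 1 p.262, Theorem p.245, §3 p.279, (2.4)–(2.5) p.255, (2.10) p.256, (2.28) p.259, (3.16)–(3.25) pp.268–270; Balaban1987RG1, Thm 1 p.259, (0.20) p.256, (1.20)–(1.22) p.264; Balaban1989LargeFieldII, Thm 1 p.355; Balaban1989LargeFieldI, (0.2)–(0.4) p.176; Balaban1985Variational, Thm 1 (7)–(9) pp.278–279, (144)–(152) pp.300–301, Prop. 8 p.304] -/
theorem exists_window_thm1Printed_gaussPinH_door_ccmwCRZ_of_betaBox (hj : 1 ≤ j) (hjm : j + 1 ≤ F.m) :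
    ∃ γ₀ : ℝ, 0 < γ₀ ∧ ∀ (γ c ε₀ ε₂₉ B₃ B₃' a₀ a₁ bl β' : ℝ) (c₁₅ : ℕ) (hc : 2 ≤ c) (hc8 : c ≤ 8) (hε : 0 < ε₀) (hε' : 0 < ε₂₉) (hB : 0 ≤ B₃) (hB' : 0 ≤ B₃')
      (ha₀ : 0 < a₀) (ha₁ : 0 < a₁) (hγ : 0 < γ) (hγle : γ ≤ γ₀) (h15 : VariationalThm1RegSepCoP7M F N B₃ a₀ a₁) (hc₁₅ : c₁₅ ≤ F.L ^ j)
      (h9 : Gauge9RegSepTopStepR F N (fun ν K Ω => suppDomOfRecord F ν K Ω) (F.L ^ j) c₁₅ B₃ B₃' a₀ a₁)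
      (hbox : BetaLowerH bl γ (betaOfRecord₁₃ F N (theta13OfThm1CCMWZ F N j γ ε₀ ε₂₉ B₃ B₃' a₀ a₁ Efl logz)))
      (hbox' : BetaUpperH β' γ (betaOfRecord₁₃ F N (theta13OfThm1CCMWZ F N j γ ε₀ ε₂₉ B₃ B₃' a₀ a₁ Efl logz))) (hl : -bl * γ ^ 2 ≤ 3) (hβ' : β' * γ ^ 2 ≤ 3 / 4)
      (θ₀ : Stage13Params F N) (hθ₀ : θ₀ = theta13LiveOfNumericsZ F N
          ({ stage12NumericsOfThm1CCMW F.L j γ ε₀ B₃ B₃' a₀ a₁ with s2 := { sect2NumericsOfThm1C F.L with cR := c } } : Stage12Numerics) ε₂₉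
          (zeta316OfRecord F N (stage12NumericsOfThm1CCMW F.L j γ ε₀ B₃ B₃' a₀ a₁).ν (stage12NumericsOfThm1CCMW F.L j γ ε₀ B₃ B₃' a₀ a₁).τ9.M
            (stage12NumericsOfThm1CCMW F.L j γ ε₀ B₃ B₃' a₀ a₁).A₁) (RzOfRecord F N) (ZtOfRecord F N) Efl logz),
      (∀ P : B12.RunParams, Step.InInterval γ P.K (gOfRecord₁₃ F N θ₀ P) → ∀ i, 1 ≤ i → i ≤ P.K →
        ∀ (s : SeqOfRecord F θ₀.ν θ₀.τ9.M (gOfRecord₁₃ F N θ₀ P) P.K i) (V : GaugeField (F.P P.K) i (SU N)),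
        chiSeqOfRecord F N θ₀.ν θ₀.τ9.M (gOfRecord₁₃ F N θ₀ P) P.K i s V ≠ 0 →
        ∀ a ∈ cubesIn (fun a : ↥(cubeIndices (F.P P.K) (cubeSide (F.P P.K).L θ₀.ν.M₂ (RkOfRecord (F.P P.K).L θ₀.ν.r (gOfRecord₁₃ F N θ₀ P i)) i)) =>
            cubeEnl (F.P P.K) (cubeSide (F.P P.K).L θ₀.ν.M₂ (RkOfRecord (F.P P.K).L θ₀.ν.r (gOfRecord₁₃ F N θ₀ P i)) i) a 0) (s.Ω i),
          ∃ U₀, IsMinimizer (avOfRecord F N P.K) {U | PlaqSmall (θ₀.ν.εreg * (F.P P.K).eta i ^ 2) U}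
            (Bj θ₀.ν.M₁ (cubeEnl (F.P P.K) (cubeSide (F.P P.K).L θ₀.ν.M₂ (RkOfRecord (F.P P.K).L θ₀.ν.r (gOfRecord₁₃ F N θ₀ P i)) i) a 4) i)
            (avgFamily (avOfRecord F N P.K) (qsstarGIter0 i V)) U₀) →
      ∀ (σ : (P : B12.RunParams) → Sect3Supplier (gaussPinH (Stage13HParams.ofHistoryBlind F N ⟨θ₀, ZrOfRecord₁₃ F N θ₀⟩)) P),
      (∀ P : B12.RunParams, Step.InInterval γ P.K (gOfRecord₁₃ F N θ₀ P) → SupplierObligations (gaussPinH (Stage13HParams.ofHistoryBlind F N ⟨θ₀, ZrOfRecord₁₃ F N θ₀⟩)) P (σ P)) →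
      (∀ P : B12.RunParams, Step.InInterval γ P.K (gOfRecord₁₃ F N θ₀ P) → SupplierBorel (gaussPinH (Stage13HParams.ofHistoryBlind F N ⟨θ₀, ZrOfRecord₁₃ F N θ₀⟩)) P (σ P)) →
      (Stage13HParams.ofHistoryBlind F N ⟨θ₀, ZrOfRecord₁₃ F N θ₀⟩).Provisos₁₃SepCoPH F N ∧
      ∀ hG : (Stage13HParams.ofHistoryBlind F N ⟨θ₀, ZrOfRecord₁₃ F N θ₀⟩).Provisos₁₃SepCoPH F N,
        B16.Thm1Printed (datumOfRecord₁₃SepCoPH F N (gaussPinH (Stage13HParams.ofHistoryBlind F N ⟨θ₀, ZrOfRecord₁₃ F N θ₀⟩)) (provisos₁₃SepCoPH_gaussPinH hG)).C := by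
  obtain ⟨γ₀, hγ₀, hall⟩ := exists_window_ccmShape (L := F.L) F.hL.2.le j N
  refine ⟨γ₀, hγ₀, fun γ c ε₀ ε₂₉ B₃ B₃' a₀ a₁ bl β' c₁₅ hc hc8 hε hε' hB hB' ha₀ ha₁ hγ hγle h15 hc₁₅ h9 hbox hbox' hl hβ' θ₀ hθ₀ hsolv σ hσ hσB => ?_⟩
  obtain ⟨hγe, h3γ, hRγ, hε3γ, hε2γ⟩ := hall γ hγ hγle
  exact ⟨provisos₁₃SepCoPH_door_ccmwCRZ_of_gauge9TopStepR_of_betaBoxSignFree_allTorus hθ₀ (by linarith) hc8 hγ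
      (hγe.trans (Real.exp_neg_one_lt_d9.le.trans (by norm_num))) hε hε' hB hB' ha₀ ha₁ h15 hc₁₅ h9 hbox hbox' hl hβ',
    fun _ => thm1Printed_gaussPinH_door_ccmwCRZ_of_supplierBorel_of_solvable_of_hjm hθ₀ hjm hc hc8 hj hε hε' hB hB' ha₀ ha₁ hγ hγe h3γ hRγ hε3γ hε2γ h15 hc₁₅ h9
      hbox hbox' hl hβ' hsolv σ hσ hσB⟩



end Window

/-! ## §3  The explicit window γ₁₁ⁿᵘᵐ(L, j, N) in the type -/

section Explicit

variable {F : T4Family} {N : ℕ} [NeZero N] {j c₁₅ : ℕ} {γ c ε₀ ε₂₉ B₃ B₃' a₀ a₁ bl β' : ℝ} {Efl logz : B12.RunParams → ℕ → ℝ} {θ₀ : Stage13Params F N}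

/-- **★★★★ N11's PRINTED OUTPUT AT THE cR-LETTERED z-z-MEMBER's HISTORY-BLIND DOOR ON THE EXPLICIT WINDOW** `0 < γ ≤ γ₁₁ⁿᵘᵐ(F.L, j, N)` (value in the type), `c ∈ [2, 8]`, `1 ≤ j`,
`j + 1 ≤ F.m`, Part 14 §0c's letters, per-window-run K0 solvability + [III] §3 supplier: the z-door key HOLDS (Z-b's door theorem) ∧ for EVERY key proof `hG`, `B16.Thm1Printed` at the K1-keyed
datum of the Gaussian certificate (§1's door theorem with the five γ-conditions from `ccmShape_of_le_explicitWindow`).  CONDITIONAL; nothing of Bałaban asserted.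
[cite: Balaban1988Convergent, Thm 1 p.262, Theorem p.245, §3 p.279, (2.4)–(2.5) p.255, (2.10) p.256, (2.28) p.259, (3.16)–(3.25) pp.268–270; Balaban1987RG1, Thm 1 p.259, (0.20) p.256, (1.20)–(1.22) p.264; Balaban1989LargeFieldII, Thm 1 p.355; Balaban1989LargeFieldI, (0.2)–(0.4) p.176; Balaban1985Variational, Thm 1 (7)–(9) pp.278–279, (144)–(152) pp.300–301, Prop. 8 p.304] -/
theorem thm1Printed_gaussPinH_door_ccmwCRZ_of_le_explicitWindow
    (hθ₀ : θ₀ = theta13LiveOfNumericsZ F N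
      ({ stage12NumericsOfThm1CCMW F.L j γ ε₀ B₃ B₃' a₀ a₁ with s2 := { sect2NumericsOfThm1C F.L with cR := c } } : Stage12Numerics) ε₂₉
      (zeta316OfRecord F N (stage12NumericsOfThm1CCMW F.L j γ ε₀ B₃ B₃' a₀ a₁).ν (stage12NumericsOfThm1CCMW F.L j γ ε₀ B₃ B₃' a₀ a₁).τ9.M
        (stage12NumericsOfThm1CCMW F.L j γ ε₀ B₃ B₃' a₀ a₁).A₁) (RzOfRecord F N) (ZtOfRecord F N) Efl logz)
    (hjm : j + 1 ≤ F.m) (hc2 : 2 ≤ c) (hc8 : c ≤ 8) (hj : 1 ≤ j) (hε : 0 < ε₀) (hε' : 0 < ε₂₉) (hB : 0 ≤ B₃) (hB' : 0 ≤ B₃') (ha₀ : 0 < a₀) (ha₁ : 0 < a₁)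
    (hγ0 : 0 < γ) (hγle : γ ≤ min (Real.exp (-(3 * (F.L : ℝ) ^ j + 8 * F.L + 3)))
      ((min (16 / (3 * 36608)) (16 * ExpMeanLog.deltaSU (Fin N) / ((8 * F.L : ℕ) : ℝ) ^ 2) / 4) ^ 2))
    (h15 : VariationalThm1RegSepCoP7M F N B₃ a₀ a₁) (hc₁₅ : c₁₅ ≤ F.L ^ j)
    (h9 : Gauge9RegSepTopStepR F N (fun ν K Ω => suppDomOfRecord F ν K Ω) (F.L ^ j) c₁₅ B₃ B₃' a₀ a₁)
    (hbox : BetaLowerH bl γ (betaOfRecord₁₃ F N (theta13OfThm1CCMWZ F N j γ ε₀ ε₂₉ B₃ B₃' a₀ a₁ Efl logz)))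
    (hbox' : BetaUpperH β' γ (betaOfRecord₁₃ F N (theta13OfThm1CCMWZ F N j γ ε₀ ε₂₉ B₃ B₃' a₀ a₁ Efl logz))) (hl : -bl * γ ^ 2 ≤ 3) (hβ' : β' * γ ^ 2 ≤ 3 / 4)
    (hsolv : ∀ P : B12.RunParams, Step.InInterval γ P.K (gOfRecord₁₃ F N θ₀ P) → ∀ i, 1 ≤ i → i ≤ P.K →
      ∀ (s : SeqOfRecord F θ₀.ν θ₀.τ9.M (gOfRecord₁₃ F N θ₀ P) P.K i) (V : GaugeField (F.P P.K) i (SU N)),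
      chiSeqOfRecord F N θ₀.ν θ₀.τ9.M (gOfRecord₁₃ F N θ₀ P) P.K i s V ≠ 0 →
      ∀ a ∈ cubesIn (fun a : ↥(cubeIndices (F.P P.K) (cubeSide (F.P P.K).L θ₀.ν.M₂ (RkOfRecord (F.P P.K).L θ₀.ν.r (gOfRecord₁₃ F N θ₀ P i)) i)) =>
          cubeEnl (F.P P.K) (cubeSide (F.P P.K).L θ₀.ν.M₂ (RkOfRecord (F.P P.K).L θ₀.ν.r (gOfRecord₁₃ F N θ₀ P i)) i) a 0) (s.Ω i),
        ∃ U₀, IsMinimizer (avOfRecord F N P.K) {U | PlaqSmall (θ₀.ν.εreg * (F.P P.K).eta i ^ 2) U}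
          (Bj θ₀.ν.M₁ (cubeEnl (F.P P.K) (cubeSide (F.P P.K).L θ₀.ν.M₂ (RkOfRecord (F.P P.K).L θ₀.ν.r (gOfRecord₁₃ F N θ₀ P i)) i) a 4) i)
          (avgFamily (avOfRecord F N P.K) (qsstarGIter0 i V)) U₀)
    (σ : (P : B12.RunParams) → Sect3Supplier (gaussPinH (Stage13HParams.ofHistoryBlind F N ⟨θ₀, ZrOfRecord₁₃ F N θ₀⟩)) P)
    (hσ : ∀ P : B12.RunParams, Step.InInterval γ P.K (gOfRecord₁₃ F N θ₀ P) → SupplierObligations (gaussPinH (Stage13HParams.ofHistoryBlind F N ⟨θ₀, ZrOfRecord₁₃ F N θ₀⟩)) P (σ P))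
    (hσB : ∀ P : B12.RunParams, Step.InInterval γ P.K (gOfRecord₁₃ F N θ₀ P) → SupplierBorel (gaussPinH (Stage13HParams.ofHistoryBlind F N ⟨θ₀, ZrOfRecord₁₃ F N θ₀⟩)) P (σ P)) :
    (Stage13HParams.ofHistoryBlind F N ⟨θ₀, ZrOfRecord₁₃ F N θ₀⟩).Provisos₁₃SepCoPH F N ∧
    ∀ hG : (Stage13HParams.ofHistoryBlind F N ⟨θ₀, ZrOfRecord₁₃ F N θ₀⟩).Provisos₁₃SepCoPH F N,
      B16.Thm1Printed (datumOfRecord₁₃SepCoPH F N (gaussPinH (Stage13HParams.ofHistoryBlind F N ⟨θ₀, ZrOfRecord₁₃ F N θ₀⟩)) (provisos₁₃SepCoPH_gaussPinH hG)).C := by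
  obtain ⟨hγe, h3γ, hRγ, hε3γ, hε2γ⟩ := ccmShape_of_le_explicitWindow (L := F.L) F.hL.2.le j N hγ0 hγle
  exact ⟨provisos₁₃SepCoPH_door_ccmwCRZ_of_gauge9TopStepR_of_betaBoxSignFree_allTorus hθ₀ (by linarith) hc8 hγ0
      (hγe.trans (Real.exp_neg_one_lt_d9.le.trans (by norm_num))) hε hε' hB hB' ha₀ ha₁ h15 hc₁₅ h9 hbox hbox' hl hβ',
    fun _ => thm1Printed_gaussPinH_door_ccmwCRZ_of_supplierBorel_of_solvable_of_hjm hθ₀ hjm hc2 hc8 hj hε hε' hB hB' ha₀ ha₁ hγ0 hγe h3γ hRγ hε3γ hε2γ h15 hc₁₅ h9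
      hbox hbox' hl hβ' hsolv σ hσ hσB⟩


end Explicit

end Summit.QuantumFields.YangMills.Theorems.BalabanUVNodesN11Thm1PrintedAtCRLetteredMemberOfBgFactsZ

end
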